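import Literature.Analysis.Complex.JensenPolynomialEffectiveConvergence
import Literature.Analysis.Complex.JensenPolynomialCircleKernelDetection
import Literature.NumberTheory.LFunctions.JensenPolyaProofs
import Literature.Barriers.RiemannHypothesis.JensenPolynomialsChasse
import HarnessLib

/-!
# The row `n = 0` of the Jensen grid of `ξ` detects isolated off-line zeros: the effective converse
# direction of Chasse's theorem (typed obstruction; all proved)

Barrier catalogue `Literature/Barriers/RiemannHypothesis/` (D-0021); sibling of
`JensenPolynomialsChasse.lean`, which proves Chasse's theorem [Chasse2013, Thm. 1.8; as printed in
Farmer2022 §4 and KimLee2021 Thm. 4]: RH up to height `T` makes `J^{d,0}_γ` (`γ = xiTaylorCoeff`,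
`J^{d,n}_γ = jensenPoly γ d n`, [GORZPNAS2019, §1]) hyperbolic for every `d ≤ T²`. This file records
the CONVERSE direction with an explicit degree, from the effective Craven–Csordas bound and the
quantitative Hurwitz theorem of `Literature/Analysis/Complex/JensenPolynomialEffectiveConvergence.lean`
(namespace `Literature.Analysis.Complex.JensenDetection`): a simple zero `w₀` of `G`
(`G(w²) = ξ(½+w)`, the tree's `xiSq`; `8G = Σ γⱼ wʲ/j!`) OFF the real axis — i.e. an off-line zero of
`ζ` — isolated in `‖w - w₀‖ ≤ ρ ≤ |Im w₀|` with modulus floor `m ≤ 8|G|` on the circle forces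
`J^{d,0}_γ` NON-hyperbolic as soon as `E_γ(‖w₀‖+ρ)/(2d) < m`, `E_γ(R) = Σⱼ j(j-1)|γⱼ|Rʲ/j!`.

Read contrapositively this is a typed obstruction for the corner `n = 0` (and by shift, the
log-shore rows) of the Jensen grid: hyperbolicity of the row `n = 0` up to degree `D` is squeezed
between «RH up to height `√D`» (sufficient, Chasse) and «every off-line zero of `ζ` is non-isolated
at detection degree `D`» (necessary) — both statements about zeros of `ζ`. A `(d,n)`-UNIFORM
hyperbolicity mechanism that reaches the row `n = 0` is therefore an RH-verification mechanism
(cell rh-jensen, ladder LADDER-RH J-P(P3): the region `n < c·d³` below the cubic range is where the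
RH-EQUIVALENT content lives). RH itself is not touched: nothing here is evidence for or against RH.

## Contents (all proved; no definitions)

* `xi_not_splits_of_offLine_zero` — the `ξ` instance of the detection theorem.
* `xi_offLine_zero_nonisolated_of_rowZero_hyperbolic` — the contrapositive (typed obstruction).
* `xi_offLine_zero_nonisolated_of_platt_trudgian` — today's instance, `D = 9·10²⁴`, from the named
  fact `platt_trudgian_numerical_rh` [PlattTrudgianBLMS2021, Thm. 1] through
  `jensenPoly_xiTaylorCoeff_splits_of_platt_trudgian`.
* `riemannHypothesis_of_forall_splits_jensenPoly_rowZero` — for the record: hyperbolicity of the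
  whole row `n = 0` already implies RH (Pólya–Schur [CravenCsordas1989, §1 (i)]; the tree's
  `polya_jensen` is the two-parameter criterion).

Provenance: cell rh-jensen (D-0074 GROUP I, negation lens round 2, `NegationLensR2Sketch.lean` §N4,
planner-rh-jensen-idea-2-g2-0, 2026-08-26; the heuristic «detection-degree law» of the cell memo
NEGATION-LENS-R2.md is NOT formalised here), landed by prover-rh-jensen-eng-2-g2-0. AI-produced
formalisation; AI review is weaker than expert review.

## References
* [Chasse2013] M. Chasse, Complex Var. Elliptic Equ. 58 (2013) 875–885, Thm. 1.8 (through
  [Farmer2022] D. W. Farmer, Adv. Math. 411 (2022), §4, and [KimLee2021] Thm. 4).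
* [KimLee2021] Y.-O. Kim, J. Lee, arXiv:2105.05386, Thm. 4 and Remark.
* [CravenCsordas1989] T. Craven, G. Csordas, Pacific J. Math. 136 (1989) 241–260, §1 (i), Lemma 2.2.
* [GORZPNAS2019] M. Griffin, K. Ono, L. Rolen, D. Zagier, PNAS 116 (2019) 11103–11110, §1.
* [PlattTrudgianBLMS2021] D. Platt, T. Trudgian, Bull. LMS 53 (2021), Thm. 1.
-/

open Polynomial Complex Filter Topology Metric Set
open scoped ComplexConjugate Nat

namespace Literature.Barriers.RiemannHypothesis

open Literature.NumberTheory.LFunctions Literature.Analysis.Complex.PolyaSchur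
  Literature.Analysis.Complex Literature.Analysis.Complex.JensenDetection

/-! ## Detection of a hypothetical off-line zero of `ξ` in the row `n = 0` -/

/-- **Detection of a hypothetical off-line zero of `ξ` by the row `n = 0` of the Jensen grid.** With
`F = 8G`, `G(w²) = ξ(½ + w)` (`xiSq`; `γ(k) = 8G⁽ᵏ⁾(0)`, `hasSum_xiTaylorCoeff_div_factorial_mul_pow`):
a simple zero `w₀` of `G` with `Im w₀ ≠ 0` — i.e. `w₀ = (ρ_ζ - ½)²` for a zero `ρ_ζ` of `ζ` OFF the
critical line (`exists_zero_of_xiSq_eq_zero`) — which is the only zero of `G` in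
`‖w - w₀‖ ≤ ρ ≤ |Im w₀|`, with `m ≤ 8|G|` on the circle `‖w - w₀‖ = ρ`, makes `J^{d,0}_γ`
NON-hyperbolic for every `d ≥ 1` with `E_γ(‖w₀‖+ρ)/(2d) < m`, `E_γ(R) = Σⱼ j(j-1)|γⱼ|Rʲ/j!`
(`Literature.Analysis.Complex.JensenDetection.not_splits_jensenPoly_of_offLine_zero` for `ξ`). The
effective converse direction of Chasse's theorem `jensenPoly_xiTaylorCoeff_splits_of_rh_upTo`.
[cite: Chasse2013, Theorem 1.8 (converse direction, effective)]
[cite: CravenCsordas1989, Lemma 2.2] [cite: GORZPNAS2019, §1 and footnote] -/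
theorem xi_not_splits_of_offLine_zero {w₀ : ℂ} {ρ m : ℝ} (hρ : 0 < ρ) (hρim : ρ ≤ |w₀.im|)
    (hw₀ : xiSq w₀ = 0) (hw₀' : deriv xiSq w₀ ≠ 0)
    (huniq : ∀ v ∈ closedBall w₀ ρ, xiSq v = 0 → v = w₀)
    (hm : ∀ w : ℂ, ‖w - w₀‖ = ρ → m ≤ 8 * ‖xiSq w‖) {d : ℕ} (hd : 0 < d)
    (herr : (∑' j : ℕ, ((j : ℝ) * ((j : ℝ) - 1)) *
        (|xiTaylorCoeff j| / (j ! : ℝ) * (‖w₀‖ + ρ) ^ j)) / (2 * d) < m) :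
    ¬ (jensenPoly xiTaylorCoeff d 0).Splits := by
  have hF : ∀ w : ℂ, HasSum (fun j => (xiTaylorCoeff j : ℂ) / (j ! : ℂ) * w ^ j)
      ((fun w => 8 * xiSq w) w) := hasSum_xiTaylorCoeff_div_factorial_mul_pow
  refine not_splits_jensenPoly_of_offLine_zero hF (differentiable_xiSq.const_mul 8) hρ hρim
    (by simp [hw₀]) ?_ (fun v hv h0 => huniq v hv (by simpa using h0)) (fun w hw => ?_)
    summable_abs_xiTaylorCoeff_div_factorial_mul_pow hd herr
  · rw [deriv_const_mul _ (differentiable_xiSq w₀)]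
    simpa using hw₀'
  · simpa [norm_mul] using hm w hw

/-- **Typed obstruction (contrapositive).** If the row `n = 0` of the Jensen grid of `ξ` is
hyperbolic up to degree `D ≥ 1` (as Chasse's theorem delivers from RH up to height `√D`,
`jensenPoly_xiTaylorCoeff_splits_of_rh_upTo`), then every simple off-line zero `w₀` of `G` is NOT
`(ρ, m)`-isolated at scale `D`: on every circle `‖w - w₀‖ = ρ ≤ |Im w₀|` inside which `w₀` is the
only zero, `min 8|G| ≤ E_γ(‖w₀‖+ρ)/(2D)`. Hyperbolicity of the row up to `D` is thus squeezed between
«RH up to height `√D`» (sufficient, Chasse) and «no isolated off-line zero of detection degree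
`≤ D`» (necessary) — both statements about ZEROS OF `ζ`: a `(d,n)`-uniform hyperbolicity mechanism
reaching the row `n = 0` must produce zero-free / zero-isolation information.
[cite: Chasse2013, Theorem 1.8 (converse direction, effective)] [cite: KimLee2021, Theorem 4] -/
theorem xi_offLine_zero_nonisolated_of_rowZero_hyperbolic {D : ℕ} (hD : 0 < D)
    (hrow : ∀ d : ℕ, d ≤ D → (jensenPoly xiTaylorCoeff d 0).Splits)
    {w₀ : ℂ} {ρ m : ℝ} (hρ : 0 < ρ) (hρim : ρ ≤ |w₀.im|)
    (hw₀ : xiSq w₀ = 0) (hw₀' : deriv xiSq w₀ ≠ 0)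
    (huniq : ∀ v ∈ closedBall w₀ ρ, xiSq v = 0 → v = w₀)
    (hm : ∀ w : ℂ, ‖w - w₀‖ = ρ → m ≤ 8 * ‖xiSq w‖) :
    m ≤ (∑' j : ℕ, ((j : ℝ) * ((j : ℝ) - 1)) *
        (|xiTaylorCoeff j| / (j ! : ℝ) * (‖w₀‖ + ρ) ^ j)) / (2 * D) := by
  by_contra h
  push Not at h
  exact xi_not_splits_of_offLine_zero hρ hρim hw₀ hw₀' huniq hm hD h (hrow D le_rfl)

/-- **Today's instance of the obstruction.** Given the Platt–Trudgian verification of RH to height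
`3·10¹²` (named fact `platt_trudgian_numerical_rh`), the row `n = 0` is hyperbolic up to
`D = 9·10²⁴` (`jensenPoly_xiTaylorCoeff_splits_of_platt_trudgian`, Chasse/Kim–Lee), hence every
simple off-line zero of `G` is non-isolated at scale `9·10²⁴` in the above sense.
[cite: PlattTrudgianBLMS2021, Theorem 1] [cite: KimLee2021, Theorem 4 and Remark]
[cite: Chasse2013, Theorem 1.8] -/
theorem xi_offLine_zero_nonisolated_of_platt_trudgian (hPT : platt_trudgian_numerical_rh)
    {w₀ : ℂ} {ρ m : ℝ} (hρ : 0 < ρ) (hρim : ρ ≤ |w₀.im|)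
    (hw₀ : xiSq w₀ = 0) (hw₀' : deriv xiSq w₀ ≠ 0)
    (huniq : ∀ v ∈ closedBall w₀ ρ, xiSq v = 0 → v = w₀)
    (hm : ∀ w : ℂ, ‖w - w₀‖ = ρ → m ≤ 8 * ‖xiSq w‖) :
    m ≤ (∑' j : ℕ, ((j : ℝ) * ((j : ℝ) - 1)) *
        (|xiTaylorCoeff j| / (j ! : ℝ) * (‖w₀‖ + ρ) ^ j)) / (2 * ((9 * 10 ^ 24 : ℕ) : ℝ)) :=
  xi_offLine_zero_nonisolated_of_rowZero_hyperbolic (by norm_num)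
    (fun _ hd => jensenPoly_xiTaylorCoeff_splits_of_platt_trudgian hPT hd) hρ hρim hw₀ hw₀' huniq hm

/-! ## The row `n = 0` alone is an RH criterion (Pólya–Schur), for the record -/

/-- **Hyperbolicity of the whole row `n = 0` implies RH** (Pólya–Schur: `F ∈ 𝓛𝓟` iff all
`J^{d,0}` are hyperbolic; here the direction «all `J^{d,0}_γ` hyperbolic ⇒ `G` has only real zeros ⇒
RH», assembled from the tree's `im_eq_zero_of_forall_splits_jensenPoly` (Hurwitz) and
`riemannHypothesis_of_forall_xiSq_eq_zero_im_eq_zero`). The converse for EVERY `d` is Chasse's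
theorem applied at every height, i.e. RH itself; the tree's `polya_jensen` is the two-parameter
form. This pins the RH-EQUIVALENT target that the detection degree quantifies.
[cite: CravenCsordas1989, §1 (i) (Pólya–Schur)] [cite: GORZPNAS2019, Theorem 1 (discussion)] -/
theorem riemannHypothesis_of_forall_splits_jensenPoly_rowZero
    (h : ∀ d : ℕ, (jensenPoly xiTaylorCoeff d 0).Splits) : RiemannHypothesis := by
  refine riemannHypothesis_of_forall_xiSq_eq_zero_im_eq_zero fun z hz => ?_
  have hF : ∀ w : ℂ, HasSum (fun j => (xiTaylorCoeff j : ℂ) / (j ! : ℂ) * w ^ j)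
      ((fun w => 8 * xiSq w) w) := hasSum_xiTaylorCoeff_div_factorial_mul_pow
  refine im_eq_zero_of_forall_splits_jensenPoly summable_abs_xiTaylorCoeff_div_factorial_mul_pow
    hF (differentiable_xiSq.const_mul 8) (by simpa using xiSq_zero_ne) h ?_
  simp [hz]

/-! ## The local (winding-form) instance: no simplicity, no isolation (appended 2026-08-26) -/

/-- **The `ξ` instance of the LOCAL detection criterion** (`F = 8G`, `G(w²) = ξ(½+w)` = `xiSq`):
a zero `η₀` of `G` of ANY multiplicity — other zeros of `G` allowed anywhere, in particular inside
the disc — in an open disc `B(c, r)` with `r < |Im c|`, together with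
`localErr (8G) d w < 8‖G(w)‖` on the circle `‖w − c‖ = r` (the Gaussian-lens error functional of
`Literature.Analysis.Complex.JensenCircleKernel`), makes `J^{d,0}_γ` non-hyperbolic
(`JensenCircleKernel.not_splits_jensenPoly_of_local_criterion`, winding Rouché). This weakens the
hypotheses of `xi_not_splits_of_offLine_zero` above (simple zero, unique in the closed ball, GLOBAL
majorant `E_γ(‖w₀‖+ρ)/(2d)`, which for `ξ` is `≍ ξ(½+γ₀)`-sized, i.e. an exponential detection
degree); the local functional is what makes a polynomial detection degree possible (cell memo
NEGATION-LENS-R3.md, THEOREM A — not formalised here). [cite: Chasse2013, Theorem 1.8 (converse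
direction, local form)] [cite: Conway1978, Ch. V §3 (Rouché)] [cite: CravenCsordas1989, Lemma 2.2] -/
theorem xi_not_splits_of_local_criterion {c η₀ : ℂ} {r : ℝ} (hr : 0 < r) (hrim : r < |c.im|)
    (hη₀ : ‖η₀ - c‖ < r) (hG : xiSq η₀ = 0) {d : ℕ} (hd : 0 < d)
    (hloc : ∀ w : ℂ, ‖w - c‖ = r →
      JensenCircleKernel.localErr (fun w => 8 * xiSq w) d w < 8 * ‖xiSq w‖) :
    ¬ (jensenPoly xiTaylorCoeff d 0).Splits := by
  have hF : ∀ w : ℂ, HasSum (fun j => (xiTaylorCoeff j : ℂ) / (j ! : ℂ) * w ^ j)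
      ((fun w => 8 * xiSq w) w) := hasSum_xiTaylorCoeff_div_factorial_mul_pow
  refine JensenCircleKernel.not_splits_jensenPoly_of_local_criterion hF
    summable_abs_xiTaylorCoeff_div_factorial_mul_pow (differentiable_xiSq.const_mul 8) hr hrim hη₀
    (by simp [hG]) hd fun w hw => ?_
  simpa [norm_mul] using hloc w hw

end Literature.Barriers.RiemannHypothesis
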